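import Summits.HubbardSuperconductivity.HubbardSuperconductivity.Theorems.AnisotropyChordTransferFibre3FinXCCover

/-!
# Route `AnisotropyChord` / H0 rotor rung: FIN combined (rows `N₁` + C) certificate at `L = 11` — cell facts, part `j`

Kernel facts `xbcCellAny 11 (49/50) 20 la lb (c, bn) = true` (`decide +kernel`, zero data) for 5 λ-cells of the per-`L` cover
(`…FinXCCover.xbcCheck`; cell design: p3 g5 scratch `xbc_design.py`, mirrors `xb_mirror.py`/`xc_mirror.py`); assembled in `…FinXBCEleven`.
Prover seat `hubbard-h0-rotor-p3` g5; helper for piece A = stmt-HubbardSuperconductivity-23918 of rung 19089 (`--supports`, helper class).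
WHAT THIS IS NOT: nothing here proves superconductivity in the Hubbard model (rotor TARGET as worded stays FALSE, g15 verdict); kernel facts for the FIN certificate of two hypotheses (rows `N₁`, C) of ONE conditional reduction.  Tree imports only; no sorry, no new axioms.
-/

set_option linter.dupNamespace false

namespace Summit.HubbardSuperconductivity.HubbardSuperconductivity.Theorems.AnisotropyChord.Transfer.Fibre3

namespace FinXB

set_option maxHeartbeats 4000000 in
/-- kernel fact: cell 58 at `L = 11` (certified, c = (1/2 : ℚ), b = 13/20). [folklore] -/
theorem xbc11_58 : xbcCellAny 11 (49/50 : ℚ) 20 1979696375651880 2029188785043177 ((1/2 : ℚ), (13 : ℕ)) = true := by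
  decide +kernel

set_option maxHeartbeats 4000000 in
/-- kernel fact: cell 59 at `L = 11` (certified, c = (1/2 : ℚ), b = 13/20). [folklore] -/
theorem xbc11_59 : xbcCellAny 11 (49/50 : ℚ) 20 2029188785043177 2079918504669257 ((1/2 : ℚ), (13 : ℕ)) = true := by
  decide +kernel

set_option maxHeartbeats 4000000 in
/-- kernel fact: cell 60 at `L = 11` (certified, c = (1/2 : ℚ), b = 13/20). [folklore] -/
theorem xbc11_60 : xbcCellAny 11 (49/50 : ℚ) 20 2079918504669257 2131916467285989 ((1/2 : ℚ), (13 : ℕ)) = true := by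
  decide +kernel

set_option maxHeartbeats 4000000 in
/-- kernel fact: cell 61 at `L = 11` (certified, c = (1/2 : ℚ), b = 13/20). [folklore] -/
theorem xbc11_61 : xbcCellAny 11 (49/50 : ℚ) 20 2131916467285989 2185214378968139 ((1/2 : ℚ), (13 : ℕ)) = true := by
  decide +kernel

set_option maxHeartbeats 4000000 in
/-- kernel fact: cell 62 at `L = 11` (certified, c = (1/2 : ℚ), b = 13/20). [folklore] -/
theorem xbc11_62 : xbcCellAny 11 (49/50 : ℚ) 20 2185214378968139 2239844738442343 ((1/2 : ℚ), (13 : ℕ)) = true := by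
  decide +kernel

end FinXB

end Summit.HubbardSuperconductivity.HubbardSuperconductivity.Theorems.AnisotropyChord.Transfer.Fibre3
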